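import Literature.MathematicalPhysics.QuantumLattice.HubbardHighTemperatureDecay
import Literature.MathematicalPhysics.QuantumLattice.HubbardFermiLiquidRealProofs
import Mathlib.Analysis.Normed.Group.FunctionSeries
import Mathlib.Analysis.Normed.Ring.InfiniteSum
import Mathlib.Analysis.SpecialFunctions.Exp
import HarnessLib

/-!
# The infinite-volume two-point function at high temperature: summability and a continuous
momentum distribution

Continuation of `HubbardHighTemperatureTwoPoint.lean` / `HubbardHighTemperatureDecay.lean` (the
high-temperature corner `0 ≤ β ≤ β₀ = SourceGas.betaHT` of the fact `bgm_two_point_limit`, all real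
`U, μ`). The thermodynamic limit `S_{β,U,μ,σ}(z) = lim_L ⟨c†_{0σ} c_{zσ}⟩_{β,L}` is packaged as a
function on `ℤ²` (`htTwoPointLimit`, via `limUnder`) and shown to be

* the limit of `⟨c†_{xσ} c_{yσ}⟩_{β,L}` for all `x, y` with `y - x = z` (`tendsto_htTwoPointLimit_sub`),
  real (`htTwoPointLimit_im`), bounded by `1`, and exponentially decaying:
  `|S(z)| ≤ (4/β₀) e^{-(‖z‖_∞ + 1)}` (`norm_htTwoPointLimit_le`);
* **summable over `ℤ²`, even against exponential weights `e^{a‖z‖_∞}`, `a < 1`**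
  (`summable_norm_htTwoPointLimit_mul_exp`, `summable_htTwoPointLimit`);
* hence its Fourier series, the **momentum distribution** `n_σ(k) = Σ_z e^{ik·z} S(z)`
  (`htMomentumDist`), converges absolutely and uniformly and is a CONTINUOUS function of
  `k ∈ ℝ²` (`continuous_htMomentumDist`): at high temperature the Hubbard model has no sharp Fermi
  surface (contrast with the Fermi-liquid regime `β ≤ e^{a/|U|}`, `β → ∞` of
  Benfatto–Giuliani–Mastropietro, where the wave-function renormalisation stays `1 + O(U²)` and the
  zero-temperature momentum distribution would jump at the Fermi surface).

Also `summable_exp_neg_mul_supNorm_two`: `Σ_{z ∈ ℤ²} e^{-c‖z‖_∞} < ∞` for `c > 0` (comparison with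
the product of two geometric series), kept free of the Ising import closure.

## References

* D. Ueltschi, J. Stat. Phys. 95 (1999) 693, Thm. 2.1 (ii)–(iii) (thermodynamic limit and
  exponential clustering at high temperature). [Ueltschi1999]
* G. Benfatto, A. Giuliani, V. Mastropietro, Ann. Henri Poincaré 7 (2006) 809, §1 (Fermi liquid
  behaviour of the momentum-space two-point function; the fact `bgm_two_point_limit`). [BenfattoGiulianiMastropietro2006]
-/

noncomputable section

namespace Literature.MathematicalPhysics.QuantumLattice

open Matrix Finset HubbardWave0 Literature.Probability.LatticeModels Filter
open scoped _root_.Topology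

/-! ### Summability of `e^{-c‖z‖_∞}` over `ℤ²` -/

/-- `Σ_{n ∈ ℤ} e^{-c|n|} < ∞` for `c > 0`. [folklore] -/
theorem summable_exp_neg_mul_natAbs_int {c : ℝ} (hc : 0 < c) : Summable fun n : ℤ => Real.exp (-c * (n.natAbs : ℝ)) := by
  have hnat : Summable fun n : ℕ => Real.exp (-c * (n : ℝ)) := by
    have h := Real.summable_exp_nat_mul_iff.2 (neg_lt_zero.2 hc)
    refine h.congr fun n => ?_
    rw [mul_comm]
  refine Summable.of_nat_of_neg ?_ ?_
  · simpa using hnat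
  · simpa using hnat

/-- **`Σ_{z ∈ ℤ²} e^{-c‖z‖_∞} < ∞` for `c > 0`** (`‖z‖_∞ ≥ (|z₀| + |z₁|)/2` and two geometric
series). [folklore] -/
theorem summable_exp_neg_mul_supNorm_two {c : ℝ} (hc : 0 < c) : Summable fun z : Site 2 => Real.exp (-c * (Site.supNorm z : ℝ)) := by
  have h1 := summable_exp_neg_mul_natAbs_int (half_pos hc)
  have hprod : Summable fun p : ℤ × ℤ => Real.exp (-(c / 2) * (p.1.natAbs : ℝ)) * Real.exp (-(c / 2) * (p.2.natAbs : ℝ)) :=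
    h1.mul_of_nonneg h1 (fun _ => (Real.exp_pos _).le) (fun _ => (Real.exp_pos _).le)
  have hSite : Summable ((fun p : ℤ × ℤ => Real.exp (-(c / 2) * (p.1.natAbs : ℝ)) * Real.exp (-(c / 2) * (p.2.natAbs : ℝ))) ∘
      (piFinTwoEquiv fun _ => ℤ)) := (Equiv.summable_iff (piFinTwoEquiv fun _ => ℤ)).2 hprod
  refine hSite.of_nonneg_of_le (fun z => (Real.exp_pos _).le) fun z => ?_
  show Real.exp (-c * (Site.supNorm z : ℝ)) ≤ Real.exp (-(c / 2) * ((z 0).natAbs : ℝ)) * Real.exp (-(c / 2) * ((z 1).natAbs : ℝ))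
  rw [← Real.exp_add]
  refine Real.exp_le_exp.2 ?_
  have h0 : ((z 0).natAbs : ℝ) ≤ Site.supNorm z := by exact_mod_cast Site.natAbs_le_supNorm z 0
  have h1' : ((z 1).natAbs : ℝ) ≤ Site.supNorm z := by exact_mod_cast Site.natAbs_le_supNorm z 1
  nlinarith

/-! ### The infinite-volume two-point function at high temperature -/

/-- The thermodynamic limit `S_{β,U,μ,σ}(z) = lim_{L→∞} ⟨c†_{0σ} c_{zσ}⟩_{β,L}` (a `limUnder`; it is
the limit whenever the limit exists, in particular for `0 ≤ β ≤ β₀`). [cite: Ueltschi1999, Thm. 2.1 (ii)] -/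
def htTwoPointLimit (β U μ : ℝ) (σ : Fin 2) (z : Site 2) : ℂ :=
  limUnder atTop fun L : ℕ => hubbardThermalTwoPoint β U μ L 0 z σ σ

/-- For `0 ≤ β ≤ β₀`: `⟨c†_{0σ} c_{zσ}⟩_{β,L} → S(z)`. [cite: Ueltschi1999, Thm. 2.1 (ii)] -/
theorem tendsto_htTwoPointLimit {β : ℝ} (hβ0 : 0 ≤ β) (hβ : β ≤ SourceGas.betaHT) (U μ : ℝ) (σ : Fin 2) (z : Site 2) :
    Tendsto (fun L : ℕ => hubbardThermalTwoPoint β U μ L 0 z σ σ) atTop (𝓝 (htTwoPointLimit β U μ σ z)) :=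
  tendsto_nhds_limUnder (SourceGas.exists_tendsto_hubbardThermalTwoPoint_zero hβ0 hβ U μ z σ)

/-- For `0 ≤ β ≤ β₀` and all `x, y`: `⟨c†_{xσ} c_{yσ}⟩_{β,L} → S(y - x)` (translation invariance).
[cite: Ueltschi1999, Thm. 2.1 (ii)] -/
theorem tendsto_htTwoPointLimit_sub {β : ℝ} (hβ0 : 0 ≤ β) (hβ : β ≤ SourceGas.betaHT) (U μ : ℝ) (σ : Fin 2) (x y : Site 2) :
    Tendsto (fun L : ℕ => hubbardThermalTwoPoint β U μ L x y σ σ) atTop (𝓝 (htTwoPointLimit β U μ σ (y - x))) := by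
  have h := tendsto_htTwoPointLimit hβ0 hβ U μ σ (y - x)
  refine h.congr fun L => ?_
  rw [hubbardThermalTwoPoint_eq_sub β U μ L x y]

/-- `S(z)` is real. [cite: BenfattoGiulianiMastropietro2006, §2.1 (symmetries (4), (5))] -/
theorem htTwoPointLimit_im {β : ℝ} (hβ0 : 0 ≤ β) (hβ : β ≤ SourceGas.betaHT) (U μ : ℝ) (σ : Fin 2) (z : Site 2) :
    (htTwoPointLimit β U μ σ z).im = 0 :=
  im_eq_zero_of_tendsto_hubbardThermalTwoPoint (tendsto_htTwoPointLimit hβ0 hβ U μ σ z)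

/-- `|S(z)| ≤ 1`. [cite: BratteliRobinsonII1997, §5.3.1] -/
theorem norm_htTwoPointLimit_le_one {β : ℝ} (hβ0 : 0 ≤ β) (hβ : β ≤ SourceGas.betaHT) (U μ : ℝ) (σ : Fin 2) (z : Site 2) :
    ‖htTwoPointLimit β U μ σ z‖ ≤ 1 :=
  le_of_tendsto (tendsto_htTwoPointLimit hβ0 hβ U μ σ z).norm
    (Filter.Eventually.of_forall fun L => norm_hubbardThermalTwoPoint_le_one β U μ L 0 z σ σ)

/-- **Exponential decay**: `|S(z)| ≤ (4/β₀) e^{-(‖z‖_∞ + 1)}`. [cite: Ueltschi1999, Thm. 2.1 (iii)] -/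
theorem norm_htTwoPointLimit_le {β : ℝ} (hβ0 : 0 ≤ β) (hβ : β ≤ SourceGas.betaHT) (U μ : ℝ) (σ : Fin 2) (z : Site 2) :
    ‖htTwoPointLimit β U μ σ z‖ ≤ 4 * Real.exp (-(Site.supNorm z + 1 : ℕ)) / SourceGas.betaHT := by
  have h := norm_lim_hubbardThermalTwoPoint_le_exp_neg hβ0 hβ U μ 0 z σ σ (tendsto_htTwoPointLimit hβ0 hβ U μ σ z)
  rwa [sub_zero] at h

/-- **Summability against exponential weights**: `Σ_z |S(z)| e^{a‖z‖_∞} < ∞` for every `a < 1`.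
[cite: Ueltschi1999, Thm. 2.1 (iii)] -/
theorem summable_norm_htTwoPointLimit_mul_exp {β : ℝ} (hβ0 : 0 ≤ β) (hβ : β ≤ SourceGas.betaHT) (U μ : ℝ) (σ : Fin 2)
    {a : ℝ} (ha : a < 1) :
    Summable fun z : Site 2 => ‖htTwoPointLimit β U μ σ z‖ * Real.exp (a * (Site.supNorm z : ℝ)) := by
  have hs := (summable_exp_neg_mul_supNorm_two (sub_pos.2 ha)).mul_left (4 * Real.exp (-1) / SourceGas.betaHT)
  refine hs.of_nonneg_of_le (fun z => mul_nonneg (norm_nonneg _) (Real.exp_pos _).le) fun z => ?_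
  have hb := norm_htTwoPointLimit_le hβ0 hβ U μ σ z
  have hβpos := SourceGas.betaHT_pos
  calc ‖htTwoPointLimit β U μ σ z‖ * Real.exp (a * (Site.supNorm z : ℝ))
      ≤ 4 * Real.exp (-(Site.supNorm z + 1 : ℕ)) / SourceGas.betaHT * Real.exp (a * (Site.supNorm z : ℝ)) :=
        mul_le_mul_of_nonneg_right hb (Real.exp_pos _).le
    _ = 4 * Real.exp (-1) / SourceGas.betaHT * Real.exp (-(1 - a) * (Site.supNorm z : ℝ)) := by
        have e : Real.exp (-(Site.supNorm z + 1 : ℕ)) * Real.exp (a * (Site.supNorm z : ℝ)) =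
            Real.exp (-1) * Real.exp (-(1 - a) * (Site.supNorm z : ℝ)) := by
          rw [← Real.exp_add, ← Real.exp_add]; congr 1; push_cast; ring
        have e2 : 4 * Real.exp (-(Site.supNorm z + 1 : ℕ)) / SourceGas.betaHT * Real.exp (a * (Site.supNorm z : ℝ)) =
            4 / SourceGas.betaHT * (Real.exp (-(Site.supNorm z + 1 : ℕ)) * Real.exp (a * (Site.supNorm z : ℝ))) := by ring
        rw [e2, e]
        ring

/-- In particular `S ∈ ℓ¹(ℤ²)`. [cite: Ueltschi1999, Thm. 2.1 (iii)] -/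
theorem summable_norm_htTwoPointLimit {β : ℝ} (hβ0 : 0 ≤ β) (hβ : β ≤ SourceGas.betaHT) (U μ : ℝ) (σ : Fin 2) :
    Summable fun z : Site 2 => ‖htTwoPointLimit β U μ σ z‖ := by
  have h := summable_norm_htTwoPointLimit_mul_exp hβ0 hβ U μ σ (a := 0) one_pos
  refine h.congr fun z => ?_
  rw [zero_mul, Real.exp_zero, mul_one]

/-- `S` is summable. [cite: Ueltschi1999, Thm. 2.1 (iii)] -/
theorem summable_htTwoPointLimit {β : ℝ} (hβ0 : 0 ≤ β) (hβ : β ≤ SourceGas.betaHT) (U μ : ℝ) (σ : Fin 2) :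
    Summable (htTwoPointLimit β U μ σ) :=
  (summable_norm_htTwoPointLimit hβ0 hβ U μ σ).of_norm

/-- `S(-z) = S(z)` (parity). [cite: BenfattoGiulianiMastropietro2006, §2.1 (symmetry (4))] -/
theorem htTwoPointLimit_neg (β U μ : ℝ) (σ : Fin 2) (z : Site 2) :
    htTwoPointLimit β U μ σ (-z) = htTwoPointLimit β U μ σ z := by
  have hf : (fun L : ℕ => hubbardThermalTwoPoint β U μ L 0 (-z) σ σ) = fun L : ℕ => hubbardThermalTwoPoint β U μ L 0 z σ σ := by
    funext L
    have h := hubbardThermalTwoPoint_neg β U μ L 0 z σ σ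
    rwa [neg_zero] at h
  unfold htTwoPointLimit
  rw [hf]

/-! ### The momentum distribution -/

/-- The phase `k · z`. [folklore] -/
def kdotSite (k : Fin 2 → ℝ) (z : Site 2) : ℝ := ∑ j, k j * (z j : ℝ)

/-- `k · (-z) = -(k · z)`. [folklore] -/
theorem kdotSite_neg (k : Fin 2 → ℝ) (z : Site 2) : kdotSite k (-z) = -kdotSite k z := by
  simp [kdotSite, Finset.sum_neg_distrib, mul_neg]

/-- `k ↦ k · z` is continuous. [folklore] -/
theorem continuous_kdotSite (z : Site 2) : Continuous fun k : Fin 2 → ℝ => kdotSite k z := by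
  unfold kdotSite
  fun_prop

/-- The **momentum distribution** at high temperature: the Fourier series
`n_σ(k) = Σ_{z ∈ ℤ²} e^{i k·z} S_{β,U,μ,σ}(z)` of the infinite-volume one-particle density matrix.
[cite: BenfattoGiulianiMastropietro2006, §1 (momentum-space two-point function)] -/
def htMomentumDist (β U μ : ℝ) (σ : Fin 2) (k : Fin 2 → ℝ) : ℂ :=
  ∑' z : Site 2, Complex.exp ((kdotSite k z : ℝ) * Complex.I) * htTwoPointLimit β U μ σ z

/-- The terms of the Fourier series are bounded by `|S(z)|`, uniformly in `k`. [folklore] -/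
theorem norm_exp_mul_htTwoPointLimit_eq (β U μ : ℝ) (σ : Fin 2) (k : Fin 2 → ℝ) (z : Site 2) :
    ‖Complex.exp ((kdotSite k z : ℝ) * Complex.I) * htTwoPointLimit β U μ σ z‖ = ‖htTwoPointLimit β U μ σ z‖ := by
  rw [norm_mul, Complex.norm_exp_ofReal_mul_I, one_mul]

/-- For `0 ≤ β ≤ β₀` the Fourier series converges absolutely. [cite: Ueltschi1999, Thm. 2.1 (iii)] -/
theorem hasSum_htMomentumDist {β : ℝ} (hβ0 : 0 ≤ β) (hβ : β ≤ SourceGas.betaHT) (U μ : ℝ) (σ : Fin 2) (k : Fin 2 → ℝ) :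
    HasSum (fun z : Site 2 => Complex.exp ((kdotSite k z : ℝ) * Complex.I) * htTwoPointLimit β U μ σ z) (htMomentumDist β U μ σ k) := by
  refine (Summable.of_norm ?_).hasSum
  simp_rw [norm_exp_mul_htTwoPointLimit_eq]
  exact summable_norm_htTwoPointLimit hβ0 hβ U μ σ

/-- `|n_σ(k)| ≤ Σ_z |S(z)|` uniformly in `k`. [cite: Ueltschi1999, Thm. 2.1 (iii)] -/
theorem norm_htMomentumDist_le {β : ℝ} (hβ0 : 0 ≤ β) (hβ : β ≤ SourceGas.betaHT) (U μ : ℝ) (σ : Fin 2) (k : Fin 2 → ℝ) :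
    ‖htMomentumDist β U μ σ k‖ ≤ ∑' z : Site 2, ‖htTwoPointLimit β U μ σ z‖ := by
  have h := summable_norm_htTwoPointLimit hβ0 hβ U μ σ
  unfold htMomentumDist
  refine (norm_tsum_le_tsum_norm ?_).trans_eq (tsum_congr fun z => norm_exp_mul_htTwoPointLimit_eq β U μ σ k z)
  simp_rw [norm_exp_mul_htTwoPointLimit_eq]
  exact h

/-- **The momentum distribution is continuous at high temperature** (uniformly convergent Fourier
series): no sharp Fermi surface for `0 ≤ β ≤ β₀`. [cite: Ueltschi1999, Thm. 2.1 (iii)] -/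
theorem continuous_htMomentumDist {β : ℝ} (hβ0 : 0 ≤ β) (hβ : β ≤ SourceGas.betaHT) (U μ : ℝ) (σ : Fin 2) :
    Continuous (htMomentumDist β U μ σ) := by
  unfold htMomentumDist
  refine continuous_tsum (fun z => ?_) (summable_norm_htTwoPointLimit hβ0 hβ U μ σ) fun z k =>
    (norm_exp_mul_htTwoPointLimit_eq β U μ σ k z).le
  exact ((Complex.continuous_ofReal.comp (continuous_kdotSite z)).mul continuous_const).cexp.mul continuous_const

/-- The momentum distribution is even: `n_σ(-k) = n_σ(k)` (parity `S(-z) = S(z)`).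
[cite: BenfattoGiulianiMastropietro2006, §2.1 (symmetry (4))] -/
theorem htMomentumDist_neg (β U μ : ℝ) (σ : Fin 2) (k : Fin 2 → ℝ) :
    htMomentumDist β U μ σ (-k) = htMomentumDist β U μ σ k := by
  unfold htMomentumDist
  rw [← (Equiv.neg (Site 2)).tsum_eq]
  refine tsum_congr fun z => ?_
  simp only [Equiv.neg_apply, htTwoPointLimit_neg, kdotSite_neg]
  congr 2
  simp [kdotSite, Finset.sum_neg_distrib]

/-- **The momentum distribution is real** (`S` real and even). [cite: BenfattoGiulianiMastropietro2006, §2.1 (symmetries (4), (5))] -/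
theorem star_htMomentumDist {β : ℝ} (hβ0 : 0 ≤ β) (hβ : β ≤ SourceGas.betaHT) (U μ : ℝ) (σ : Fin 2) (k : Fin 2 → ℝ) :
    star (htMomentumDist β U μ σ k) = htMomentumDist β U μ σ k := by
  have hS : ∀ z, star (htTwoPointLimit β U μ σ z) = htTwoPointLimit β U μ σ z := fun z => by
    rw [Complex.star_def]
    exact Complex.conj_eq_iff_im.2 (htTwoPointLimit_im hβ0 hβ U μ σ z)
  calc star (htMomentumDist β U μ σ k)
      = ∑' z : Site 2, Complex.exp ((kdotSite k (-z) : ℝ) * Complex.I) * htTwoPointLimit β U μ σ z := by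
        unfold htMomentumDist
        rw [tsum_star]
        refine tsum_congr fun z => ?_
        rw [star_mul', hS z, kdotSite_neg, Complex.ofReal_neg, Complex.star_def, ← Complex.exp_conj, map_mul,
          Complex.conj_ofReal, Complex.conj_I, mul_neg, neg_mul]
    _ = ∑' z : Site 2, Complex.exp ((kdotSite k z : ℝ) * Complex.I) * htTwoPointLimit β U μ σ (-z) := by
        rw [← (Equiv.neg (Site 2)).tsum_eq]
        refine tsum_congr fun z => ?_
        simp only [Equiv.neg_apply, neg_neg]
    _ = htMomentumDist β U μ σ k := by
        unfold htMomentumDist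
        exact tsum_congr fun z => by rw [htTwoPointLimit_neg]

end Literature.MathematicalPhysics.QuantumLattice

end
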